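import Literature.RepresentationTheory.Liu2021.LocalOscillatorRepresentation
import Literature.RepresentationTheory.CentralCharacterQuotient
import HarnessLib

/-!
# Liu 2021, App. B §B.1, Step 3 — assembling the local oscillator datum from `(ω(μ, ε), E¹, χ, n)`

Kernel glue (no citation content): the record datum
`Literature.RepresentationTheory.Liu2021.LocalOscillatorDatum` asks for the maximal `χ`-quotient
of `ω(μ, ε)` as data (`quot`, `proj`, `proj_surjective`, `proj_comm`, `ker_proj`).  The generic
module operation `Literature.RepresentationTheory.CentralCharacterQuotient.quotRep` supplies all of
it, so an instance is determined by the representation `ω(μ, ε) = ω(ε) ∘ ι_μ` of `U(V)(F)`, the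
central inclusion `E¹ ↪ U(V)`, the character `χ` and the rank `n ≥ 2`: constructor
`LocalOscillatorDatum.ofCentralChar`.  The record `IrreducibleAdmissible` of the assembled datum
unfolds to a statement about `quotRep` (lemma `irreducibleAdmissible_ofCentralChar_iff`), which is
what a consumer instantiating [Liu 2021, Lemma B.1] at a finite place cites.
-/

namespace Literature.RepresentationTheory.Liu2021.LocalOscillatorDatum

open Literature.RepresentationTheory.CentralCharacterQuotient

universe uG uZ uV

variable {G : Type uG} {Z : Type uZ} [Group G] [TopologicalSpace G] [CommGroup Z]
  {V : Type uV} [AddCommGroup V] [Module ℂ V]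

/-- **Constructor of the Liu datum from Step-3 inputs**: `omega := ω`, `zeta := ζ`, `chi := χ`,
`quot := quotRep ω hζ χ` on `V ⧸ augmentation ω ζ χ`, `proj := mkQ`, `rank := n`. [folklore] -/
def ofCentralChar (ω : Representation ℂ G V) (ζ : Z →* G) (hζ : ∀ z, ζ z ∈ Subgroup.center G)
    (χ : Z →* ℂˣ) (n : ℕ) (hn : 2 ≤ n) :
    LocalOscillatorDatum G Z V (V ⧸ augmentation ω ζ χ) where
  omega := ω
  zeta := ζ
  zeta_mem_center := hζ
  chi := χ
  quot := quotRep ω hζ χ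
  proj := (augmentation ω ζ χ).mkQ
  proj_surjective := mkQ_surjective ω ζ χ
  proj_comm := fun g v => mkQ_apply_comm ω hζ χ g v
  ker_proj := ker_mkQ ω ζ χ
  rank := n
  two_le_rank := hn

section

variable (ω : Representation ℂ G V) (ζ : Z →* G) (hζ : ∀ z, ζ z ∈ Subgroup.center G)
  (χ : Z →* ℂˣ) (n : ℕ) (hn : 2 ≤ n)

/-- unfolding: the representation field. [folklore] -/
@[simp] theorem ofCentralChar_omega : (ofCentralChar ω ζ hζ χ n hn).omega = ω := rfl

/-- unfolding: the quotient representation field. [folklore] -/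
@[simp] theorem ofCentralChar_quot : (ofCentralChar ω ζ hζ χ n hn).quot = quotRep ω hζ χ := rfl

/-- unfolding: the quotient map field. [folklore] -/
@[simp] theorem ofCentralChar_proj :
    (ofCentralChar ω ζ hζ χ n hn).proj = (augmentation ω ζ χ).mkQ := rfl

/-- unfolding: the rank field. [folklore] -/
@[simp] theorem ofCentralChar_rank : (ofCentralChar ω ζ hζ χ n hn).rank = n := rfl

/-- unfolding: the character field. [folklore] -/
@[simp] theorem ofCentralChar_chi : (ofCentralChar ω ζ hζ χ n hn).chi = χ := rfl

/-- The record of the assembled datum, unfolded: [Liu 2021, Lemma B.1] for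
`ω(μ, ε, χ) = quotRep ω hζ χ`. [folklore] -/
theorem irreducibleAdmissible_ofCentralChar_iff :
    (ofCentralChar ω ζ hζ χ n hn).IrreducibleAdmissible ↔
      (quotRep ω hζ χ).IsAdmissible ∧
        (Nontrivial (V ⧸ augmentation ω ζ χ) → (quotRep ω hζ χ).IsIrreducible) ∧
        (n ≠ 2 → Nontrivial (V ⧸ augmentation ω ζ χ)) :=
  Iff.rfl

/-- Consumer form for the pub-hodgecm cell (`n = 3`): from the cited record, `ω(μ, ε, χ)` is
irreducible and admissible. [folklore] -/
theorem isIrreducible_and_isAdmissible_of_rank_three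
    (h : (ofCentralChar ω ζ hζ χ 3 (by norm_num)).IrreducibleAdmissible) :
    (quotRep ω hζ χ).IsIrreducible ∧ (quotRep ω hζ χ).IsAdmissible :=
  ⟨h.isIrreducible_of_rank_eq_three rfl, h.isAdmissible⟩

end

end Literature.RepresentationTheory.Liu2021.LocalOscillatorDatum
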